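import Literature.AnabelianGeometry.AbsoluteAnabelian.AbsTopIICor33iiNodeReclose
import Literature.AnabelianGeometry.AbsoluteAnabelian.FreeProSigmaNonVacuity
import Summits.ABC.IUTFork.FreeProfiniteUniqueRootsNoGo
import HarnessLib

/-!
# [AbsTopII] Cor 3.3 (ii): the two renderings of "torsion-free" SEPARATE inside the corollary itself —
# at one model the print-faithful `Cor_3_3_iiTF` holds and the unique-roots predecessor `Cor_3_3_ii` fails

S. Mochizuki, *Topics in Absolute Anabelian Geometry II* [AbsTopII] (bib `MochizukiAbsTopII2013`), §3,
Corollary 3.3 (ii) p. 68 ("… open subgroups `J ⊆ Π_C` of index `2` such that `J ∩ Δ_C` … is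
torsion-free").  PROOF-ONLY file (cell abc-iut, seat abc-iut-L4-t10 gen 13, row «K4 RE-CLOSE
AbsTopII:Cor3.3(ii)»): the kernel composition of three landed results —
* abc-iut-L4-t10's `AbsTopII.exists_cor_3_3_iiTF_geometricModel` (Literature side, p498811): at the
  geometric semi-elliptic model `Π_D = F̂₂ ↪ Π_C = F̂₂ ⋊ {±1}`, `Cor_3_3_iiTF M` holds and
  `Cor_3_3_ii M ↔ IsMulTorsionFree F̂₂`;
* abc-iut-L4's `isFreeProOn_profiniteCompletion_freeGroup` (`F̂₂` is free pro-`𝔓𝔯𝔦𝔪𝔢𝔰` on its letters);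
* abc-iut-L4-t12's `Summit.ABC.IUTFork.not_isMulTorsionFree_of_isFreeProOn` (finding T1g11-F1, kernel
  half: a free pro-`Σ` group of rank `≥ 2` with `2, 3 ∈ Σ` does not have unique roots) —
giving `exists_cor_3_3_iiTF_and_not_cor_3_3_ii`: SOME model with a semi-elliptic curve satisfies the
successor (FACT-LIST F-0234's successor-of-record candidate) and REFUTES the predecessor (F-0234 as
typed).  Lives Summits-side only because the third input is not importable into `Literature/`.

HONEST FRAMING: statements about OUR typings at a MODEL (trivial Galois group); model ≠ reconstruction;
typed ≠ proved; no side taken on [IUTchIII] Cor 3.12; nothing here asserts that abc is proved or refuted.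
-/

noncomputable section

namespace Summit.ABC.IUTFork

open Literature.AnabelianGeometry.AbsoluteAnabelian
open Literature.AnabelianGeometry.AbsoluteAnabelian.AbsTopII

/-- **`F̂₂` does not have unique roots** (the profinite completion of the free group on two letters is
not `IsMulTorsionFree`): abc-iut-L4-t12's no-go at the genuine inhabitant
`isFreeProOn_profiniteCompletion_freeGroup 2`. [cite: MochizukiAbsTopII2013, Cor 3.3 (ii) p.68] -/
theorem not_isMulTorsionFree_profiniteCompletion_freeGroup_two :
    ¬ IsMulTorsionFree
      (ProfiniteGrp.ProfiniteCompletion.completion (GrpCat.of (FreeGroup (Fin 2)))) :=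
  not_isMulTorsionFree_of_isFreeProOn (isFreeProOn_profiniteCompletion_freeGroup 2) le_rfl
    Nat.prime_two Nat.prime_three

/-- **Separation inside [AbsTopII] Cor 3.3 (ii)**: there is an isogeny-level model with a semi-elliptic
curve at which the print-faithful `Cor_3_3_iiTF` HOLDS while the unique-roots predecessor `Cor_3_3_ii`
(FACT-LIST F-0234, as typed with Mathlib's `IsMulTorsionFree`) FAILS — the geometric semi-elliptic model
`Π_D = F̂₂ ↪ Π_C = F̂₂ ⋊ {±1}` of `AbsTopII.exists_cor_3_3_iiTF_geometricModel`.  Model-level evidence.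
[cite: MochizukiAbsTopII2013, Cor 3.3 (ii) p.68] -/
theorem exists_cor_3_3_iiTF_and_not_cor_3_3_ii :
    ∃ M : IsogenyModel.{0},
      (∃ C : M.Curve, M.IsSemiElliptic C) ∧ Cor_3_3_iiTF M ∧ ¬ Cor_3_3_ii M := by
  obtain ⟨M, hTF, hiff, C, -, -, hC, -⟩ := exists_cor_3_3_iiTF_geometricModel
  exact ⟨M, ⟨C, hC⟩, hTF, fun h => not_isMulTorsionFree_profiniteCompletion_freeGroup_two (hiff.1 h)⟩

/-- Hence the predecessor and the successor are NOT equivalent across models (they agree at models with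
abelian `Δ_C`, `cor_3_3_iiTF_iff_of_comm`): `¬ ∀ M, (Cor_3_3_iiTF M ↔ Cor_3_3_ii M)`.
[cite: MochizukiAbsTopII2013, Cor 3.3 (ii) p.68] -/
theorem not_forall_cor_3_3_iiTF_iff_cor_3_3_ii :
    ¬ ∀ M : IsogenyModel.{0}, (Cor_3_3_iiTF M ↔ Cor_3_3_ii M) := by
  intro h
  obtain ⟨M, -, hTF, hnot⟩ := exists_cor_3_3_iiTF_and_not_cor_3_3_ii
  exact hnot ((h M).1 hTF)

end Summit.ABC.IUTFork

end
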